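import Literature.NumberTheory.Sieve.MaynardSieveCounting
import Literature.NumberTheory.Sieve.MaynardSieveLevel
import Literature.NumberTheory.Sieve.MaynardSieveS2
import HarnessLib

/-!
# Maynard 2015, Lemma 5.2: the residue-class count behind `S₂^{(m)}`

J. Maynard, *Small gaps between primes*, Ann. of Math. (2) 181 (2015), 383–413 = arXiv:1311.4600v3,
proof of Lemma 5.2 (pp. 10–11), first half: "We first expand out the square and swap the order of
summation … As in Lemma 5.1, we can restrict to `e_m = d_m = 1` … the inner sum can be written as a
sum over a single residue class modulo `q = W ∏ [dᵢ, eᵢ]` … The inner sum will contribute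
`X_N/φ(q) + O(E(N, q))`, `E(N, q) = 1 + sup_{(a,q)=1} |∑ χ_ℙ(n) − …|`", giving (5.16)–(5.17), and then
the error is regrouped by the modulus (a squarefree `r < R² W` arising from at most `τ_{3k}(r)`
pairs) and handed to the level-of-distribution hypothesis.

This file is the `S₂` counterpart of `MaynardSieveCounting.lean` (Lemma 5.1), again for an
ARBITRARY coefficient vector `y` supported on good tuples of the box `[1, B]^k`, `λ = lam B y`:

* `S2 W B y h v₀ N m`, `cntP` (the count with `n + h_m` prime); `S2_eq_sum_cntP`, `S2_eq_sum_boxG`;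
* `cntP_eq_zero_of_not_coprime` (incompatible pairs), `cntP_eq_zero_of_apply_ne_one` (`d_m ≠ 1`
  counts nothing once `B < N + h_m`), `S2_eq_sum_lamM` (the coefficients `λ^{(m)}_d = λ_d [d_m = 1]`
  of `MaynardSieveBilinear`);
* `exists_cntP_eq_sub` — the Chinese remainder theorem (`Literature.NumberTheory.Sieve.exists_forall_modEq_iff_modEq_prod`)
  and the bijection `n ↦ n + h_m`: `cntP(d,e) = π(X₂; q, a) − π(X₁; q, a)` with `q = W ∏ [dᵢ,eᵢ]`,
  `X₂ = 2N + h_m − 1`, `X₁ = N + h_m − 1` and a residue `a` COPRIME to `q` (from `(v₀ + h_m, W) = 1`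
  and "`p ∣ hᵢ − hⱼ ⇒ p ∣ W`"); `abs_cntP_sub_le` — `|cntP − X_N/φ(q)| ≤ E(X₂; q) + E(X₁; q)` with the
  AP error `primeCountingAPErr` of `MaynardSieveLevel.lean` and `X_N = π(X₂) − π(X₁)` (`primesX`);
* `abs_S2_sub_bilinear_le` ((5.16)–(5.17)), and with the diagonalisation `abs_S2main_sub_le` of
  `MaynardSieveBilinear.lean` ((5.18)–(5.26)) the combinatorial Lemma 5.2 `abs_S2_sub_main_le`;
* `sum_pairs_le_sum_moduli`, `sum_err_le` — regrouping by `q`: the fibres have at most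
  `τ(q)^{2k} = (4^k)^{ω(q)}` elements (`q` squarefree, `card_divisors_of_squarefree`), so
  `Σ' |λ^{(m)}_d λ^{(m)}_e| E ≤ λ_max² Σ_{q ≤ W X², q sq.free} (4^k)^{ω(q)} (E(X₂; q) + E(X₁; q))` — the
  shape consumed by `MaynardPrimesHaveLevel.isBigO_sum_pow_omega_mul` (`MaynardSieveLevel.lean`);
* `maynardS2_eq_S2`, `sum_boxG_ym_sq_div_eq`, `abs_maynardS2_sub_main_le` — the specialisation to the
  weights of Prop. 4.1, the non-asymptotic form of the named fact `Literature.NumberTheory.Sieve.maynard_lemma52`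
  (`MaynardSieveS2.lean`); the remaining bookkeeping (`X_N = N/log N + O(N/log² N)`, the level
  hypothesis at `x = X₂, X₁`, `L_g ≪ (φ(W)/W) log R`, `Z_g^K − 1 ≪ 1/D₀`) is the sequel
  `MaynardSieveLemma52.lean`.

## References

* J. Maynard, *Small gaps between primes*, Ann. of Math. (2) 181 (2015), 383–413,
  doi:10.4007/annals.2015.181.1.7 = arXiv:1311.4600v3; Lemma 5.2 and its proof, displays
  (5.16)–(5.26), pp. 10–11. [cite: MaynardAnnals2015]
-/

open Finset
open scoped BigOperators ArithmeticFunction.Moebius ArithmeticFunction.Omega ArithmeticFunction.omega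

namespace Literature.NumberTheory.Sieve
namespace MaynardSieve

variable {k : ℕ}

/-! ### `S₂^{(m)}` and the prime count in a residue class -/

/-- The prime indicator `χ_ℙ(n + h_m)` of `maynardS2` (`n + h_m` is a positive rational prime). [cite: MaynardAnnals2015, §5, definition of S₂^(m) (p. 10)] -/
noncomputable def chiP (h : Fin k → ℤ) (m : Fin k) (n : ℕ) : ℝ :=
  if 0 < (n : ℤ) + h m ∧ ((n : ℤ) + h m).toNat.Prime then 1 else 0

/-- `S₂^{(m)} = Σ_{N ≤ n < 2N, n ≡ v₀ (W)} χ_ℙ(n + h_m) (Σ_{d in the box, dᵢ ∣ n + hᵢ ∀ i} λ_d)²` for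
`λ = lam B y` (Maynard 2015 §5, p. 10, the display defining `S₂^{(m)}`, with the `dᵢ` restricted to
the box `[1, B]`). For `B = ⌊R⌋`, `y = maynardY k F R W` this is `maynardS2` (`maynardS2_eq_S2`).
[cite: MaynardAnnals2015, §5, definition of S₂^(m) (p. 10)] -/
noncomputable def S2 (W B : ℕ) (y : (Fin k → ℕ) → ℝ) (h : Fin k → ℤ) (v₀ N : ℕ) (m : Fin k) : ℝ :=
  ∑ n ∈ (Finset.Ico N (2 * N)).filter (fun n => n ≡ v₀ [MOD W]),
    chiP h m n * (∑ d ∈ (box k B).filter (fun d => ∀ i, ((d i : ℕ) : ℤ) ∣ (n : ℤ) + h i), lam B y d) ^ 2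

/-- The inner count after expanding the square:
`#{N ≤ n < 2N : n ≡ v₀ (W), dᵢ, eᵢ ∣ n + hᵢ ∀ i, n + h_m prime}` (Maynard 2015, proof of Lemma 5.2,
first display, p. 10). [cite: MaynardAnnals2015, proof of Lemma 5.2] -/
def cntP (W : ℕ) (h : Fin k → ℤ) (v₀ N : ℕ) (m : Fin k) (d e : Fin k → ℕ) : ℕ :=
  ((Finset.Ico N (2 * N)).filter fun n => n ≡ v₀ [MOD W] ∧
      (∀ i, ((d i : ℕ) : ℤ) ∣ (n : ℤ) + h i ∧ ((e i : ℕ) : ℤ) ∣ (n : ℤ) + h i) ∧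
      0 < (n : ℤ) + h m ∧ ((n : ℤ) + h m).toNat.Prime).card

/-- `χ_ℙ ∈ {0, 1}`: `χ_ℙ(n) = 1[P(n)]`. [folklore] -/
theorem chiP_eq_ite (h : Fin k → ℤ) (m : Fin k) (n : ℕ) :
    chiP h m n = if 0 < (n : ℤ) + h m ∧ ((n : ℤ) + h m).toNat.Prime then 1 else 0 := rfl

/-- **Expanding the square** (Maynard 2015, proof of Lemma 5.2, first display):
`S₂^{(m)} = Σ_{d, e} λ_d λ_e #{n : n ≡ v₀ (W), [dᵢ, eᵢ] ∣ n + hᵢ ∀ i, n + h_m prime}`.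
[cite: MaynardAnnals2015, proof of Lemma 5.2] -/
theorem S2_eq_sum_cntP (W B : ℕ) (y : (Fin k → ℕ) → ℝ) (h : Fin k → ℤ) (v₀ N : ℕ) (m : Fin k) :
    S2 W B y h v₀ N m =
      ∑ d ∈ box k B, ∑ e ∈ box k B, lam B y d * lam B y e * (cntP W h v₀ N m d e : ℝ) := by
  classical
  unfold S2
  have hsq : ∀ n : ℕ,
      chiP h m n * (∑ d ∈ (box k B).filter (fun d => ∀ i, ((d i : ℕ) : ℤ) ∣ (n : ℤ) + h i), lam B y d) ^ 2 =
        ∑ d ∈ box k B, ∑ e ∈ box k B,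
          if ((∀ i, ((d i : ℕ) : ℤ) ∣ (n : ℤ) + h i ∧ ((e i : ℕ) : ℤ) ∣ (n : ℤ) + h i) ∧
              (0 < (n : ℤ) + h m ∧ ((n : ℤ) + h m).toNat.Prime)) then
            lam B y d * lam B y e else 0 := by
    intro n
    rw [sq, Finset.sum_filter, Finset.sum_mul_sum, Finset.mul_sum]
    refine sum_congr rfl fun d _ => ?_
    rw [Finset.mul_sum]
    refine sum_congr rfl fun e _ => ?_
    rw [chiP_eq_ite]
    by_cases hd : ∀ i, ((d i : ℕ) : ℤ) ∣ (n : ℤ) + h i <;>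
      by_cases he : ∀ i, ((e i : ℕ) : ℤ) ∣ (n : ℤ) + h i <;>
        by_cases hp : 0 < (n : ℤ) + h m ∧ ((n : ℤ) + h m).toNat.Prime <;>
          simp [hd, he, hp, forall_and]
  simp_rw [hsq]
  rw [Finset.sum_comm]
  refine sum_congr rfl fun d _ => ?_
  rw [Finset.sum_comm]
  refine sum_congr rfl fun e _ => ?_
  rw [← Finset.sum_filter, Finset.filter_filter, Finset.sum_const, nsmul_eq_mul, mul_comm]
  rfl

/-- Only good tuples contribute (`λ_d = 0` off `boxG`). [cite: MaynardAnnals2015, proof of Lemma 5.2] -/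
theorem S2_eq_sum_boxG {W B : ℕ} {y : (Fin k → ℕ) → ℝ} (hy : SupportedOn W B y)
    (h : Fin k → ℤ) (v₀ N : ℕ) (m : Fin k) :
    S2 W B y h v₀ N m =
      ∑ d ∈ boxG k W B, ∑ e ∈ boxG k W B, lam B y d * lam B y e * (cntP W h v₀ N m d e : ℝ) := by
  rw [S2_eq_sum_cntP]
  have hsub : boxG k W B ⊆ box k B := Finset.filter_subset _ _
  symm
  rw [Finset.sum_subset hsub fun d _ hd => ?_]
  · refine sum_congr rfl fun d _ => Finset.sum_subset hsub fun e _ he => ?_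
    rw [lam_eq_zero_of_not hy he, mul_zero, zero_mul]
  · exact Finset.sum_eq_zero fun e _ => by rw [lam_eq_zero_of_not hy hd, zero_mul, zero_mul]

/-- The prime count is at most the plain count. [folklore] -/
theorem cntP_le_cnt (W : ℕ) (h : Fin k → ℤ) (v₀ N : ℕ) (m : Fin k) (d e : Fin k → ℕ) :
    cntP W h v₀ N m d e ≤ cnt W h v₀ N d e := by
  unfold cntP cnt
  exact Finset.card_le_card (Finset.monotone_filter_right _ fun n _ hn => ⟨hn.1, hn.2.1⟩)

/-- **Incompatible pairs count nothing** (as for `S₁`, `cnt_eq_zero_of_not_coprime`).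
[cite: MaynardAnnals2015, proof of Lemma 5.2] -/
theorem cntP_eq_zero_of_not_coprime {W : ℕ} {h : Fin k → ℤ}
    (hh : ∀ i j, i ≠ j → ∀ p : ℕ, p.Prime → (p : ℤ) ∣ h i - h j → p ∣ W) (v₀ N : ℕ) (m : Fin k)
    {d e : Fin k → ℕ} (hd : IsGood W d) {p : OffDiag k} (hp : ¬(d p.1.1).Coprime (e p.1.2)) :
    cntP W h v₀ N m d e = 0 := by
  have := cntP_le_cnt W h v₀ N m d e
  rw [cnt_eq_zero_of_not_coprime hh v₀ N hd hp] at this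
  omega

/-- **"We restrict to `d_m = e_m = 1`"** (Maynard 2015, proof of Lemma 5.2, p. 10): once `B < N + h_m`,
a tuple `d` of the box with `d_m ≠ 1` counts nothing, since `d_m ∣ n + h_m` with `n + h_m` a prime
`≥ N + h_m > B ≥ d_m > 1` is impossible. [cite: MaynardAnnals2015, proof of Lemma 5.2] -/
theorem cntP_eq_zero_of_apply_ne_one {W B : ℕ} {h : Fin k → ℤ} (v₀ : ℕ) {N : ℕ} {m : Fin k}
    (hN : (B : ℤ) < N + h m) {d : Fin k → ℕ} (hd : d ∈ box k B) (hdm : d m ≠ 1) (e : Fin k → ℕ) :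
    cntP W h v₀ N m d e = 0 := by
  rw [cntP, Finset.card_eq_zero, Finset.filter_eq_empty_iff]
  rintro n hn ⟨-, hdiv, hpos, hprime⟩
  rw [Finset.mem_Ico] at hn
  have hdm' := (mem_box.1 hd m)
  obtain ⟨hdvd, -⟩ := hdiv m
  -- `d m ∣ P` with `P = n + h m` prime, so `d m = 1` or `d m = P`
  set P : ℕ := ((n : ℤ) + h m).toNat with hP
  have hPeq : (P : ℤ) = (n : ℤ) + h m := Int.toNat_of_nonneg hpos.le
  have hdP : d m ∣ P := by
    rw [← Int.natCast_dvd_natCast, hPeq]; exact hdvd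
  rcases (Nat.dvd_prime hprime).1 hdP with h1 | h2
  · exact hdm h1
  · -- `d m = P ≥ N + h m > B`
    have : (d m : ℤ) = (n : ℤ) + h m := by rw [h2]; exact hPeq
    have hle : (d m : ℤ) ≤ B := by exact_mod_cast hdm'.2
    have hnN : (N : ℤ) ≤ n := by exact_mod_cast hn.1
    linarith

/-- The symmetric statement for `e`. [cite: MaynardAnnals2015, proof of Lemma 5.2] -/
theorem cntP_eq_zero_of_apply_ne_one' {W B : ℕ} {h : Fin k → ℤ} (v₀ : ℕ) {N : ℕ} {m : Fin k}
    (hN : (B : ℤ) < N + h m) (d : Fin k → ℕ) {e : Fin k → ℕ} (he : e ∈ box k B) (hem : e m ≠ 1) :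
    cntP W h v₀ N m d e = 0 := by
  have hsym : cntP W h v₀ N m d e = cntP W h v₀ N m e d := by
    unfold cntP
    congr 1
    refine Finset.filter_congr fun n _ => ?_
    exact ⟨fun ⟨h1, h2, h3⟩ => ⟨h1, fun i => ⟨(h2 i).2, (h2 i).1⟩, h3⟩,
      fun ⟨h1, h2, h3⟩ => ⟨h1, fun i => ⟨(h2 i).2, (h2 i).1⟩, h3⟩⟩
  rw [hsym]
  exact cntP_eq_zero_of_apply_ne_one v₀ hN he hem d

/-- With the slot-`m` coefficients `λ_d [d_m = 1]` (`lamM`): once `B < N + h_m`,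
`S₂^{(m)} = Σ_{d, e good} λ^{(m)}_d λ^{(m)}_e · cntP(d, e)`. [cite: MaynardAnnals2015, proof of Lemma 5.2] -/
theorem S2_eq_sum_lamM {W B : ℕ} {y : (Fin k → ℕ) → ℝ} (hy : SupportedOn W B y)
    (h : Fin k → ℤ) (v₀ : ℕ) {N : ℕ} (m : Fin k) (hN : (B : ℤ) < N + h m) :
    S2 W B y h v₀ N m =
      ∑ d ∈ boxG k W B, ∑ e ∈ boxG k W B, lamM B y m d * lamM B y m e * (cntP W h v₀ N m d e : ℝ) := by
  rw [S2_eq_sum_boxG hy]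
  refine sum_congr rfl fun d hd => sum_congr rfl fun e he => ?_
  rw [lamM_def, lamM_def]
  have hdb := (mem_boxG.1 hd).1
  have heb := (mem_boxG.1 he).1
  by_cases hdm : d m = 1
  · by_cases hem : e m = 1
    · rw [if_pos hdm, if_pos hem]
    · rw [cntP_eq_zero_of_apply_ne_one' v₀ hN d heb hem]; simp
  · rw [cntP_eq_zero_of_apply_ne_one v₀ hN hdb hdm e]; simp

/-! ### The count in one residue class: primes in an arithmetic progression -/

/-- `π(X; q, a)` only depends on `a mod q`. [folklore] -/
theorem primeCountingMod_mod (q a X : ℕ) : LevelOfDistribution.primeCountingMod q (a % q) X = LevelOfDistribution.primeCountingMod q a X := by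
  unfold LevelOfDistribution.primeCountingMod
  congr 1
  refine Finset.filter_congr fun p _ => ?_
  have : a % q ≡ a [MOD q] := Nat.mod_modEq a q
  exact ⟨fun ⟨hp, hm⟩ => ⟨hp, hm.trans this⟩, fun ⟨hp, hm⟩ => ⟨hp, hm.trans this.symm⟩⟩

/-- `π(X; q, a)` is monotone in `X`, and the increment counts the primes `p ≡ a (q)` in `(X₁, X₂]`.
[folklore] -/
theorem primeCountingMod_sub_eq (q a : ℕ) {X₁ X₂ : ℕ} (hX : X₁ ≤ X₂) :
    LevelOfDistribution.primeCountingMod q a X₂ - LevelOfDistribution.primeCountingMod q a X₁ =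
      ((Finset.Ioc X₁ X₂).filter fun p => p.Prime ∧ p ≡ a [MOD q]).card := by
  unfold LevelOfDistribution.primeCountingMod
  have hsub : (Finset.range (X₁ + 1)).filter (fun p => p.Prime ∧ p ≡ a [MOD q]) ⊆
      (Finset.range (X₂ + 1)).filter (fun p => p.Prime ∧ p ≡ a [MOD q]) :=
    Finset.filter_subset_filter _ (Finset.range_mono (by omega : X₁ + 1 ≤ X₂ + 1))
  rw [← Finset.card_sdiff_of_subset hsub]
  congr 1
  ext p
  rw [Finset.mem_sdiff, Finset.mem_filter, Finset.mem_filter, Finset.mem_filter, Finset.mem_range,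
    Finset.mem_range, Finset.mem_Ioc, Nat.lt_succ_iff, Nat.lt_succ_iff]
  constructor
  · rintro ⟨⟨h1, h2⟩, h3⟩
    refine ⟨⟨?_, h1⟩, h2⟩
    by_contra hle
    push Not at hle
    exact h3 ⟨hle, h2⟩
  · rintro ⟨⟨h1, h2⟩, h3⟩
    exact ⟨⟨h2, h3⟩, fun hc => absurd hc.1 (by omega)⟩


/-- **The count in one residue class, as primes in a progression** (Maynard 2015, proof of Lemma 5.2:
"the inner sum can be written as a sum over a single residue class modulo `q = W ∏ [dᵢ, eᵢ]` …
The inner sum will contribute `X_N/φ(q) + O(E(N, q))`"): for good `d, e` with `(dᵢ, eⱼ) = 1` (`i ≠ j`)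
and `d_m = e_m = 1`, `(v₀ + h_m, W) = 1`, every prime dividing some `hᵢ − hⱼ` dividing `W`, and
`N + h_m ≥ 1`: there is a residue `a` coprime to `q` with
`cntP(d, e) = π(2N + h_m − 1; q, a) − π(N + h_m − 1; q, a)`. [cite: MaynardAnnals2015, proof of Lemma 5.2] -/
theorem exists_cntP_eq_sub {W : ℕ} (hW : W ≠ 0) {h : Fin k → ℤ}
    (hh : ∀ i j, i ≠ j → ∀ p : ℕ, p.Prime → (p : ℤ) ∣ h i - h j → p ∣ W)
    {v₀ : ℕ} {m : Fin k} (hv₀ : Int.gcd ((v₀ : ℤ) + h m) W = 1)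
    {N : ℕ} (hN1 : 1 ≤ (N : ℤ) + h m)
    {d e : Fin k → ℕ} (hd : IsGood W d) (he : IsGood W e)
    (hc : ∀ p : OffDiag k, (d p.1.1).Coprime (e p.1.2)) (hdm : d m = 1) (hem : e m = 1) :
    ∃ a : ℕ, a.Coprime (W * ∏ i, Nat.lcm (d i) (e i)) ∧
      (cntP W h v₀ N m d e : ℤ) =
        (LevelOfDistribution.primeCountingMod (W * ∏ i, Nat.lcm (d i) (e i)) a (Int.toNat (2 * N + h m - 1)) : ℤ) -
          LevelOfDistribution.primeCountingMod (W * ∏ i, Nat.lcm (d i) (e i)) a (Int.toNat (N + h m - 1)) := by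
  classical
  -- the moduli `Lᵢ = [dᵢ, eᵢ]`: nonzero, coprime to `W`, pairwise coprime
  set L : Fin k → ℕ := fun i => Nat.lcm (d i) (e i) with hL
  have hL0 : ∀ i, L i ≠ 0 := fun i => Nat.lcm_ne_zero (hd.ne_zero i) (he.ne_zero i)
  have hLW : ∀ i, (L i).Coprime W := fun i =>
    Nat.Coprime.coprime_dvd_left (Nat.lcm_dvd_mul (d i) (e i))
      (Nat.Coprime.mul_left (hd.coprime_apply i) (he.coprime_apply i))
  have hLL : ∀ i j, i ≠ j → (L i).Coprime (L j) := fun i j hij => by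
    have hdd := hd.coprime_of_ne hij
    have hee := he.coprime_of_ne hij
    have hde : (d i).Coprime (e j) := hc ⟨(i, j), hij⟩
    have hed : (e i).Coprime (d j) := (hc ⟨(j, i), hij.symm⟩).symm
    refine Nat.Coprime.coprime_dvd_left (Nat.lcm_dvd_mul _ _)
      (Nat.Coprime.coprime_dvd_right (Nat.lcm_dvd_mul _ _) ?_)
    exact Nat.Coprime.mul_left (Nat.Coprime.mul_right hdd hde) (Nat.Coprime.mul_right hed hee)
  have hLm : L m = 1 := by simp only [hL, hdm, hem, Nat.lcm_self]
  -- CRT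
  obtain ⟨z, hz⟩ := Literature.NumberTheory.Sieve.exists_forall_modEq_iff_modEq_prod (Finset.univ : Finset (Fin k)) W L
    (fun i => -h i) (v₀ : ℤ) (fun i _ => hLW i) fun i _ j _ hij => hLL i j hij
  have hq0 : W * ∏ i, L i ≠ 0 := mul_ne_zero hW (Finset.prod_ne_zero_iff.2 fun i _ => hL0 i)
  set q : ℕ := W * ∏ i, L i with hqdef
  have hq0' : (q : ℤ) ≠ 0 := by exact_mod_cast hq0
  -- the defining conditions as one congruence
  have hcond : ∀ n : ℕ, (n ≡ v₀ [MOD W] ∧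
      ∀ i, ((d i : ℕ) : ℤ) ∣ (n : ℤ) + h i ∧ ((e i : ℕ) : ℤ) ∣ (n : ℤ) + h i) ↔ (n : ℤ) ≡ z [ZMOD q] := by
    intro n
    rw [hqdef, ← hz n, ← Int.natCast_modEq_iff]
    simp only [Finset.mem_univ, forall_true_left]
    refine and_congr_right fun _ => forall_congr' fun i => ?_
    rw [Int.modEq_iff_dvd, show -h i - (n : ℤ) = -((n : ℤ) + h i) by ring, dvd_neg]
    simp only [hL, Int.natCast_dvd, Nat.lcm_dvd_iff]
  -- `z ≡ v₀ (W)`, `z ≡ -hᵢ (Lᵢ)`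
  have hzv : z ≡ (v₀ : ℤ) [ZMOD W] ∧ ∀ i, z ≡ -h i [ZMOD (L i)] := by
    have := (hz z).2 (Int.ModEq.refl z)
    simpa using this
  -- the residue `a = z + h m mod q`
  set a : ℕ := Int.toNat ((z + h m) % (q : ℤ)) with hadef
  have ha : (a : ℤ) = (z + h m) % (q : ℤ) := Int.toNat_of_nonneg (Int.emod_nonneg _ hq0')
  have haz : (a : ℤ) ≡ z + h m [ZMOD q] := by rw [ha]; exact Int.mod_modEq _ _
  refine ⟨a, ?_, ?_⟩
  · -- `a` is coprime to `q`
    refine Nat.coprime_of_dvd fun p hp hpa hpq => ?_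
    have hpa' : (p : ℤ) ∣ z + h m := by
      have h1 : (p : ℤ) ∣ (a : ℤ) := Int.natCast_dvd_natCast.2 hpa
      have h2 : (q : ℤ) ∣ z + h m - a := haz.dvd
      have h3 : (p : ℤ) ∣ z + h m - a := (Int.natCast_dvd_natCast.2 hpq).trans h2
      have := dvd_add h3 h1
      rwa [sub_add_cancel] at this
    rcases (Nat.Prime.dvd_mul hp).1 hpq with hpW | hpL
    · -- `p ∣ W`: then `p ∣ v₀ + h m`, contradicting `(v₀ + h m, W) = 1`
      have h1 : (p : ℤ) ∣ z - v₀ := (Int.natCast_dvd_natCast.2 hpW).trans hzv.1.symm.dvd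
      have h2 : (p : ℤ) ∣ (v₀ : ℤ) + h m := by
        have := dvd_sub hpa' h1
        rwa [show z + h m - (z - (v₀ : ℤ)) = (v₀ : ℤ) + h m by ring] at this
      have hcop : IsCoprime ((v₀ : ℤ) + h m) (W : ℤ) := Int.isCoprime_iff_gcd_eq_one.2 hv₀
      have hunit : IsUnit (p : ℤ) := hcop.isUnit_of_dvd' h2 (Int.natCast_dvd_natCast.2 hpW)
      rw [Int.isUnit_iff_natAbs_eq, Int.natAbs_natCast] at hunit
      exact hp.one_lt.ne' hunit
    · -- `p ∣ ∏ Lᵢ`: `p ∣ Lᵢ` for some `i ≠ m`, then `p ∣ h m - h i`, so `p ∣ W`: contradiction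
      obtain ⟨i, -, hpi⟩ := (Prime.dvd_finsetProd_iff hp.prime _).1 hpL
      have him : i ≠ m := by
        rintro rfl
        rw [hLm] at hpi
        exact hp.one_lt.ne' (Nat.dvd_one.1 hpi)
      have h1 : (p : ℤ) ∣ z + h i := by
        have := (hzv.2 i).dvd  -- L i ∣ -h i - z
        have h' : (p : ℤ) ∣ -h i - z := (Int.natCast_dvd_natCast.2 hpi).trans this
        have := dvd_neg.2 h'
        rwa [show -(-h i - z) = z + h i by ring] at this
      have h2 : (p : ℤ) ∣ h m - h i := by
        have := dvd_sub hpa' h1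
        rwa [show z + h m - (z + h i) = h m - h i by ring] at this
      have hpW : p ∣ W := hh m i him.symm p hp h2
      have : p ∣ Nat.gcd (L i) W := Nat.dvd_gcd hpi hpW
      rw [hLW i] at this
      exact hp.one_lt.ne' (Nat.dvd_one.1 this)
  · -- the count: `n ↦ n + h m` is a bijection onto the primes `≡ a (q)` of `(N + h m − 1, 2N + h m − 1]`
    have hX12 : Int.toNat (N + h m - 1) ≤ Int.toNat (2 * N + h m - 1) := Int.toNat_le_toNat (by omega)
    have hX1 : ((Int.toNat ((N : ℤ) + h m - 1) : ℕ) : ℤ) = (N : ℤ) + h m - 1 := Int.toNat_of_nonneg (by omega)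
    have hX2 : ((Int.toNat (2 * (N : ℤ) + h m - 1) : ℕ) : ℤ) = 2 * (N : ℤ) + h m - 1 :=
      Int.toNat_of_nonneg (by omega)
    have hmono : LevelOfDistribution.primeCountingMod q a (Int.toNat (N + h m - 1)) ≤
        LevelOfDistribution.primeCountingMod q a (Int.toNat (2 * N + h m - 1)) := by
      unfold LevelOfDistribution.primeCountingMod
      exact Finset.card_le_card (Finset.filter_subset_filter _ (Finset.range_mono (by omega)))
    -- rewrite `cntP` with the single congruence
    have hA : cntP W h v₀ N m d e = ((Finset.Ico N (2 * N)).filter fun n : ℕ =>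
        (n : ℤ) ≡ z [ZMOD q] ∧ 0 < (n : ℤ) + h m ∧ ((n : ℤ) + h m).toNat.Prime).card := by
      unfold cntP
      congr 1
      refine Finset.filter_congr fun n _ => ?_
      rw [← hcond n]
      tauto
    rw [← Nat.cast_sub hmono, primeCountingMod_sub_eq q a hX12, Nat.cast_inj, hA]
    refine Finset.card_nbij' (fun n : ℕ => ((n : ℤ) + h m).toNat) (fun p : ℕ => ((p : ℤ) - h m).toNat)
      ?_ ?_ ?_ ?_
    · intro n hn
      rw [Finset.mem_coe, Finset.mem_filter, Finset.mem_Ico] at hn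
      obtain ⟨⟨hNn, hn2⟩, hnz, hpos, hprime⟩ := hn
      rw [Finset.mem_coe, Finset.mem_filter, Finset.mem_Ioc]
      have hp : ((((n : ℤ) + h m).toNat : ℕ) : ℤ) = (n : ℤ) + h m := Int.toNat_of_nonneg hpos.le
      refine ⟨⟨?_, ?_⟩, hprime, ?_⟩
      · have : ((Int.toNat ((N : ℤ) + h m - 1) : ℕ) : ℤ) < ((((n : ℤ) + h m).toNat : ℕ) : ℤ) := by
          rw [hX1, hp]; omega
        exact_mod_cast this
      · have : ((((n : ℤ) + h m).toNat : ℕ) : ℤ) ≤ ((Int.toNat (2 * (N : ℤ) + h m - 1) : ℕ) : ℤ) := by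
          rw [hX2, hp]; omega
        exact_mod_cast this
      · rw [← Int.natCast_modEq_iff, hp]
        exact (hnz.add_right (h m)).trans haz.symm
    · intro p hp
      rw [Finset.mem_coe, Finset.mem_filter, Finset.mem_Ioc] at hp
      obtain ⟨⟨hp1, hp2⟩, hprime, hpa⟩ := hp
      have hp1' : (N : ℤ) + h m ≤ p := by
        have : ((Int.toNat ((N : ℤ) + h m - 1) : ℕ) : ℤ) < p := by exact_mod_cast hp1
        rw [hX1] at this; omega
      have hp2' : (p : ℤ) ≤ 2 * (N : ℤ) + h m - 1 := by
        have : (p : ℤ) ≤ ((Int.toNat (2 * (N : ℤ) + h m - 1) : ℕ) : ℤ) := by exact_mod_cast hp2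
        rwa [hX2] at this
      have hn : ((((p : ℤ) - h m).toNat : ℕ) : ℤ) = (p : ℤ) - h m := Int.toNat_of_nonneg (by omega)
      rw [Finset.mem_coe, Finset.mem_filter, Finset.mem_Ico]
      refine ⟨⟨?_, ?_⟩, ?_, ?_, ?_⟩
      · have : (N : ℤ) ≤ ((((p : ℤ) - h m).toNat : ℕ) : ℤ) := by rw [hn]; omega
        exact_mod_cast this
      · have : ((((p : ℤ) - h m).toNat : ℕ) : ℤ) < ((2 * N : ℕ) : ℤ) := by rw [hn]; push_cast; omega
        exact_mod_cast this
      · rw [hn]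
        have h1 : (p : ℤ) ≡ a [ZMOD q] := (Int.natCast_modEq_iff).2 hpa
        have h2 := (h1.trans haz).add_right (-h m)
        rwa [show z + h m + -h m = z by ring, ← sub_eq_add_neg] at h2
      · rw [hn, sub_add_cancel]; exact_mod_cast hprime.pos
      · rw [hn, sub_add_cancel, Int.toNat_natCast]; exact hprime
    · intro n hn
      rw [Finset.mem_coe, Finset.mem_filter] at hn
      have hp : ((((n : ℤ) + h m).toNat : ℕ) : ℤ) = (n : ℤ) + h m := Int.toNat_of_nonneg hn.2.2.1.le
      dsimp only
      rw [hp, add_sub_cancel_right, Int.toNat_natCast]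
    · intro p hp
      rw [Finset.mem_coe, Finset.mem_filter, Finset.mem_Ioc] at hp
      have hp1' : (N : ℤ) + h m ≤ p := by
        have : ((Int.toNat ((N : ℤ) + h m - 1) : ℕ) : ℤ) < p := by exact_mod_cast hp.1.1
        rw [hX1] at this; omega
      have hn : ((((p : ℤ) - h m).toNat : ℕ) : ℤ) = (p : ℤ) - h m := Int.toNat_of_nonneg (by omega)
      dsimp only
      rw [hn, sub_add_cancel, Int.toNat_natCast]


/-! ### The moduli, the interval and the error weights -/

/-- The modulus `q(d, e) = W ∏ᵢ [dᵢ, eᵢ]` of a pair of tuples. [cite: MaynardAnnals2015, proof of Lemma 5.2] -/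
def qmod (W : ℕ) (d e : Fin k → ℕ) : ℕ := W * ∏ i, Nat.lcm (d i) (e i)

/-- The endpoints `X₂ = 2N + h_m − 1`, `X₁ = N + h_m − 1` of the shifted interval `n + h_m`,
`N ≤ n < 2N` (as naturals). [cite: MaynardAnnals2015, proof of Lemma 5.2] -/
def X2 (h : Fin k → ℤ) (N : ℕ) (m : Fin k) : ℕ := Int.toNat (2 * (N : ℤ) + h m - 1)

/-- See `X2`. [cite: MaynardAnnals2015, proof of Lemma 5.2] -/
def X1 (h : Fin k → ℤ) (N : ℕ) (m : Fin k) : ℕ := Int.toNat ((N : ℤ) + h m - 1)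

/-- `X_N = π(2N + h_m − 1) − π(N + h_m − 1)`, the number of primes `n + h_m`, `N ≤ n < 2N`
(Maynard's `X_N`, Lemma 5.2, up to the shift by `h_m`). [cite: MaynardAnnals2015, Lemma 5.2 (X_N)] -/
def primesX (h : Fin k → ℤ) (N : ℕ) (m : Fin k) : ℕ :=
  Nat.primeCounting (X2 h N m) - Nat.primeCounting (X1 h N m)

/-- The error weight `E(X₂; q(d,e)) + E(X₁; q(d,e))` of a pair (Maynard's `O(E(N, q))`, (5.16)).
[cite: MaynardAnnals2015, proof of Lemma 5.2, (5.16)] -/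
noncomputable def apErr (W : ℕ) (h : Fin k → ℤ) (N : ℕ) (m : Fin k) (d e : Fin k → ℕ) : ℝ :=
  primeCountingAPErr ((X2 h N m : ℕ) : ℝ) (qmod W d e) + primeCountingAPErr ((X1 h N m : ℕ) : ℝ) (qmod W d e)

/-- The error weight is nonnegative. [folklore] -/
theorem apErr_nonneg (W : ℕ) (h : Fin k → ℤ) (N : ℕ) (m : Fin k) (d e : Fin k → ℕ) :
    0 ≤ apErr W h N m d e :=
  add_nonneg (primeCountingAPErr_nonneg _ _) (primeCountingAPErr_nonneg _ _)

/-- `X₁ ≤ X₂`. [folklore] -/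
theorem X1_le_X2 (h : Fin k → ℤ) (N : ℕ) (m : Fin k) : X1 h N m ≤ X2 h N m :=
  Int.toNat_le_toNat (by omega)

/-- `primesX` cast to `ℝ` is the difference of the two values of `π`. [folklore] -/
theorem primesX_cast (h : Fin k → ℤ) (N : ℕ) (m : Fin k) :
    (primesX h N m : ℝ) = (Nat.primeCounting (X2 h N m) : ℝ) - Nat.primeCounting (X1 h N m) := by
  rw [primesX, Nat.cast_sub (Nat.monotone_primeCounting (X1_le_X2 h N m))]

/-! ### The error of one residue class: `E(X; q)` -/

/-- For `a` coprime to `q ≥ 1`: `|π(X; q, a) − π(X)/φ(q)| ≤ max_{(b,q)=1} |π(X; q, b) − π(X)/φ(q)|`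
(`primeCountingAPErr` of `MaynardSieveLevel.lean`). [folklore] -/
theorem abs_sub_le_primeCountingAPErr_of_coprime {q a : ℕ} (ha : a.Coprime q) (X : ℕ) :
    |(LevelOfDistribution.primeCountingMod q a X : ℝ) - (Nat.primeCounting X : ℝ) / Nat.totient q| ≤
      primeCountingAPErr (X : ℝ) q := by
  have h := abs_sub_le_primeCountingAPErr (X : ℝ) (ZMod.unitOfCoprime a ha)
  rw [ZMod.coe_unitOfCoprime, ZMod.val_natCast, primeCountingMod_mod, Nat.floor_natCast] at h
  exact h

/-- `φ(W ∏ Lᵢ) = φ(W) ∏ φ(Lᵢ)` for `Lᵢ` coprime to `W` and pairwise coprime. [folklore] -/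
theorem totient_mul_prod_eq {W : ℕ} {L : Fin k → ℕ} (hLW : ∀ i, (L i).Coprime W)
    (hLL : ∀ i j, i ≠ j → (L i).Coprime (L j)) :
    ((W * ∏ i, L i).totient : ℝ) = (W.totient : ℝ) * ∏ i, totAF (L i) := by
  have hcop : W.Coprime (∏ i, L i) := Nat.Coprime.prod_right fun i _ => (hLW i).symm
  rw [Nat.totient_mul hcop, Nat.cast_mul]
  congr 1
  have h := isMultiplicative_totAF.map_prod L (Finset.univ : Finset (Fin k))
    (fun i _ j _ hij => hLL i j hij)
  rw [totAF_apply] at h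
  exact h

/-- **The inner sum contributes `X_N/φ(q) + O(E(N, q))`** (Maynard 2015, proof of Lemma 5.2, (5.16)):
for good `d, e` with `(dᵢ, eⱼ) = 1` (`i ≠ j`), `d_m = e_m = 1`, `(v₀ + h_m, W) = 1`, every prime dividing
some `hᵢ − hⱼ` dividing `W`, and `N + h_m ≥ 1`,
`|cntP(d,e) − (π(2N+h_m−1) − π(N+h_m−1))/φ(q)| ≤ E(2N+h_m−1; q) + E(N+h_m−1; q)`,
`q = W ∏ [dᵢ, eᵢ]`, `E(X; q) = max_{(a,q)=1} |π(X; q, a) − π(X)/φ(q)|`. [cite: MaynardAnnals2015, proof of Lemma 5.2, (5.16)] -/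
theorem abs_cntP_sub_le {W : ℕ} (hW : W ≠ 0) {h : Fin k → ℤ}
    (hh : ∀ i j, i ≠ j → ∀ p : ℕ, p.Prime → (p : ℤ) ∣ h i - h j → p ∣ W)
    {v₀ : ℕ} {m : Fin k} (hv₀ : Int.gcd ((v₀ : ℤ) + h m) W = 1)
    {N : ℕ} (hN1 : 1 ≤ (N : ℤ) + h m)
    {d e : Fin k → ℕ} (hd : IsGood W d) (he : IsGood W e)
    (hc : ∀ p : OffDiag k, (d p.1.1).Coprime (e p.1.2)) (hdm : d m = 1) (hem : e m = 1) :
    |(cntP W h v₀ N m d e : ℝ) - (primesX h N m : ℝ) / Nat.totient (qmod W d e)| ≤ apErr W h N m d e := by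
  obtain ⟨a, ha, hcnt⟩ := exists_cntP_eq_sub hW hh hv₀ hN1 hd he hc hdm hem
  have hcnt' : (cntP W h v₀ N m d e : ℤ) =
      (LevelOfDistribution.primeCountingMod (qmod W d e) a (X2 h N m) : ℤ) - LevelOfDistribution.primeCountingMod (qmod W d e) a (X1 h N m) := hcnt
  have hcntR : (cntP W h v₀ N m d e : ℝ) =
      (LevelOfDistribution.primeCountingMod (qmod W d e) a (X2 h N m) : ℝ) - LevelOfDistribution.primeCountingMod (qmod W d e) a (X1 h N m) := by
    exact_mod_cast hcnt'
  have h2 := abs_sub_le_primeCountingAPErr_of_coprime ha (X2 h N m)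
  have h1 := abs_sub_le_primeCountingAPErr_of_coprime ha (X1 h N m)
  rw [hcntR, primesX_cast, sub_div, apErr]
  calc _ = |((LevelOfDistribution.primeCountingMod (qmod W d e) a (X2 h N m) : ℝ) -
          (Nat.primeCounting (X2 h N m) : ℝ) / Nat.totient (qmod W d e)) -
        ((LevelOfDistribution.primeCountingMod (qmod W d e) a (X1 h N m) : ℝ) -
          (Nat.primeCounting (X1 h N m) : ℝ) / Nat.totient (qmod W d e))| := by ring_nf
    _ ≤ _ := abs_sub _ _
    _ ≤ _ := add_le_add h2 h1

/-! ### The bilinear estimate for `S₂^{(m)}` -/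

/-- **Display (5.16)–(5.17)** (Maynard 2015, proof of Lemma 5.2): with `Σ'` the restriction to
`(dᵢ, eⱼ) = 1` (`i ≠ j`) and `λ^{(m)}_d = λ_d [d_m = 1]`,
`|S₂^{(m)} − (X_N/φ(W)) Σ'_{d,e} λ^{(m)}_d λ^{(m)}_e/∏ φ([dᵢ,eᵢ])| ≤ Σ'_{d,e} |λ^{(m)}_d λ^{(m)}_e| (E(X₂; q) + E(X₁; q))`,
once `B < N + h_m` (and `N + h_m ≥ 1`, `(v₀ + h_m, W) = 1`, every prime dividing some `hᵢ − hⱼ`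
dividing `W`). [cite: MaynardAnnals2015, proof of Lemma 5.2, (5.16)–(5.17)] -/
theorem abs_S2_sub_bilinear_le {W B : ℕ} (hW : W ≠ 0) {y : (Fin k → ℕ) → ℝ} (hy : SupportedOn W B y)
    {h : Fin k → ℤ} (hh : ∀ i j, i ≠ j → ∀ p : ℕ, p.Prime → (p : ℤ) ∣ h i - h j → p ∣ W)
    {v₀ : ℕ} {m : Fin k} (hv₀ : Int.gcd ((v₀ : ℤ) + h m) W = 1) {N : ℕ} (hN1 : 1 ≤ (N : ℤ) + h m)
    (hNB : (B : ℤ) < N + h m) :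
    |S2 W B y h v₀ N m - (primesX h N m : ℝ) / Nat.totient W *
        ∑ d ∈ boxG k W B, ∑ e ∈ boxG k W B,
          (if ∀ p : OffDiag k, (d p.1.1).Coprime (e p.1.2) then
            lamM B y m d * lamM B y m e / ∏ i, totAF (Nat.lcm (d i) (e i)) else 0)| ≤
      ∑ d ∈ boxG k W B, ∑ e ∈ boxG k W B,
        (if ∀ p : OffDiag k, (d p.1.1).Coprime (e p.1.2) then
          |lamM B y m d| * |lamM B y m e| * apErr W h N m d e else 0) := by
  rw [S2_eq_sum_lamM hy h v₀ m hNB, Finset.mul_sum, ← Finset.sum_sub_distrib]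
  refine (Finset.abs_sum_le_sum_abs _ _).trans (Finset.sum_le_sum fun d hd => ?_)
  rw [Finset.mul_sum, ← Finset.sum_sub_distrib]
  refine (Finset.abs_sum_le_sum_abs _ _).trans (Finset.sum_le_sum fun e he => ?_)
  have hdG := (mem_boxG.1 hd).2
  have heG := (mem_boxG.1 he).2
  by_cases hc : ∀ p : OffDiag k, (d p.1.1).Coprime (e p.1.2)
  · rw [if_pos hc, if_pos hc]
    by_cases hdm : d m = 1
    · by_cases hem : e m = 1
      · have h1 := abs_cntP_sub_le hW hh hv₀ hN1 hdG heG hc hdm hem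
        -- `φ(q) = φ(W) ∏ φ(Lᵢ)`
        have hLW : ∀ i, (Nat.lcm (d i) (e i)).Coprime W := fun i =>
          Nat.Coprime.coprime_dvd_left (Nat.lcm_dvd_mul (d i) (e i))
            (Nat.Coprime.mul_left (hdG.coprime_apply i) (heG.coprime_apply i))
        have hLL : ∀ i j, i ≠ j → (Nat.lcm (d i) (e i)).Coprime (Nat.lcm (d j) (e j)) := fun i j hij => by
          have hdd := hdG.coprime_of_ne hij
          have hee := heG.coprime_of_ne hij
          have hde : (d i).Coprime (e j) := hc ⟨(i, j), hij⟩
          have hed : (e i).Coprime (d j) := (hc ⟨(j, i), hij.symm⟩).symm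
          refine Nat.Coprime.coprime_dvd_left (Nat.lcm_dvd_mul _ _)
            (Nat.Coprime.coprime_dvd_right (Nat.lcm_dvd_mul _ _) ?_)
          exact Nat.Coprime.mul_left (Nat.Coprime.mul_right hdd hde) (Nat.Coprime.mul_right hed hee)
        have hφ := totient_mul_prod_eq (W := W) hLW hLL
        have hφW : (0 : ℝ) < Nat.totient W := by exact_mod_cast Nat.totient_pos.2 (Nat.pos_of_ne_zero hW)
        have hP : 0 < ∏ i, totAF (Nat.lcm (d i) (e i)) := Finset.prod_pos fun i _ => by
          rw [totAF_apply]
          exact_mod_cast Nat.totient_pos.2 (Nat.pos_of_ne_zero (Nat.lcm_ne_zero (hdG.ne_zero i) (heG.ne_zero i)))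
        rw [show qmod W d e = W * ∏ i, Nat.lcm (d i) (e i) from rfl, hφ] at h1
        have halg : lamM B y m d * lamM B y m e * (cntP W h v₀ N m d e : ℝ) -
            (primesX h N m : ℝ) / Nat.totient W *
              (lamM B y m d * lamM B y m e / ∏ i, totAF (Nat.lcm (d i) (e i))) =
            (lamM B y m d * lamM B y m e) *
              ((cntP W h v₀ N m d e : ℝ) - (primesX h N m : ℝ) /
                ((Nat.totient W : ℝ) * ∏ i, totAF (Nat.lcm (d i) (e i)))) := by
          field_simp
        rw [halg, abs_mul, abs_mul]
        exact mul_le_mul_of_nonneg_left h1 (by positivity)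
      · simp [lamM_def, hem]
    · simp [lamM_def, hdm]
  · rw [if_neg hc, if_neg hc]
    push Not at hc
    obtain ⟨p, hp⟩ := hc
    rw [cntP_eq_zero_of_not_coprime hh v₀ N m hdG hp]
    simp

/-- **Maynard 2015, Lemma 5.2, combinatorial form**: for `W` even, `B ≥ 1`, `y` supported on good
tuples of `[1, B]^k` with `|y^{(m)}_u| ≤ y^{(m)}_max` on good `u`, and the hypotheses of
`abs_S2_sub_bilinear_le`,
`|S₂^{(m)} − (X_N/φ(W)) Σ_u (y^{(m)}_u)²/∏ g(uᵢ)| ≤ (X_N/φ(W)) (y^{(m)}_max)² L_g^{k−1} (Z_g^K − 1) + Σ' |λ^{(m)}_d λ^{(m)}_e| (E(X₂;q) + E(X₁;q))`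
((5.16)–(5.17) plus the diagonalisation (5.18)–(5.20) = `abs_S2main_sub_le`).
[cite: MaynardAnnals2015, Lemma 5.2] -/
theorem abs_S2_sub_main_le {W B : ℕ} (hW : W ≠ 0) (hW2 : 2 ∣ W) (hB : 1 ≤ B) {y : (Fin k → ℕ) → ℝ}
    (hy : SupportedOn W B y) {m : Fin k} {ymmax : ℝ} (hym : ∀ u ∈ boxG k W B, |ym W B y m u| ≤ ymmax)
    {h : Fin k → ℤ} (hh : ∀ i j, i ≠ j → ∀ p : ℕ, p.Prime → (p : ℤ) ∣ h i - h j → p ∣ W)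
    {v₀ : ℕ} (hv₀ : Int.gcd ((v₀ : ℤ) + h m) W = 1) {N : ℕ} (hN1 : 1 ≤ (N : ℤ) + h m)
    (hNB : (B : ℤ) < N + h m) :
    |S2 W B y h v₀ N m - (primesX h N m : ℝ) / Nat.totient W *
        ∑ u ∈ boxG k W B, ym W B y m u ^ 2 / ∏ i, gAF (u i)| ≤
      (primesX h N m : ℝ) / Nat.totient W * (ymmax ^ 2 * (∑ n ∈ G1 W B, 1 / gAF n) ^ (k - 1) *
          ((∑ n ∈ G1 W B, 1 / gAF n ^ 2) ^ Fintype.card (OffDiag k) - 1)) +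
        ∑ d ∈ boxG k W B, ∑ e ∈ boxG k W B,
          (if ∀ p : OffDiag k, (d p.1.1).Coprime (e p.1.2) then
            |lamM B y m d| * |lamM B y m e| * apErr W h N m d e else 0) := by
  have h1 := abs_S2_sub_bilinear_le hW hy hh hv₀ hN1 hNB
  have h2 := abs_S2main_sub_le hW2 hB y m hym
  have hX0 : (0 : ℝ) ≤ (primesX h N m : ℝ) / Nat.totient W := by positivity
  have h3 : |(primesX h N m : ℝ) / Nat.totient W * (∑ d ∈ boxG k W B, ∑ e ∈ boxG k W B,
        (if ∀ p : OffDiag k, (d p.1.1).Coprime (e p.1.2) then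
          lamM B y m d * lamM B y m e / ∏ i, totAF (Nat.lcm (d i) (e i)) else 0)) -
      (primesX h N m : ℝ) / Nat.totient W * ∑ u ∈ boxG k W B, ym W B y m u ^ 2 / ∏ i, gAF (u i)| ≤
      (primesX h N m : ℝ) / Nat.totient W * (ymmax ^ 2 * (∑ n ∈ G1 W B, 1 / gAF n) ^ (k - 1) *
          ((∑ n ∈ G1 W B, 1 / gAF n ^ 2) ^ Fintype.card (OffDiag k) - 1)) := by
    rw [← mul_sub, abs_mul, abs_of_nonneg hX0]
    exact mul_le_mul_of_nonneg_left h2 hX0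
  calc _ ≤ _ := abs_sub_le _ ((primesX h N m : ℝ) / Nat.totient W * ∑ d ∈ boxG k W B, ∑ e ∈ boxG k W B,
        (if ∀ p : OffDiag k, (d p.1.1).Coprime (e p.1.2) then
          lamM B y m d * lamM B y m e / ∏ i, totAF (Nat.lcm (d i) (e i)) else 0)) _
    _ ≤ _ := by linarith [h1, h3]


/-! ### Regrouping the error by the modulus: multiplicities `≤ (4^k)^{ω(q)}` -/

/-- The `lcm` of two squarefree numbers is squarefree. [folklore] -/
theorem squarefree_lcm {a b : ℕ} (ha : Squarefree a) (hb : Squarefree b) : Squarefree (Nat.lcm a b) := by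
  have ha0 := ha.ne_zero
  have hb0 := hb.ne_zero
  rw [Nat.squarefree_iff_factorization_le_one (Nat.lcm_ne_zero ha0 hb0)]
  intro p
  rw [Nat.factorization_lcm ha0 hb0, Finsupp.sup_apply]
  exact sup_le ((Nat.squarefree_iff_factorization_le_one ha0).1 ha p)
    ((Nat.squarefree_iff_factorization_le_one hb0).1 hb p)

/-- A product of pairwise coprime squarefree numbers is squarefree (local copy of the `S₁`-side lemma,
for `Fin k`). [folklore] -/
theorem squarefree_prod_fin {L : Fin k → ℕ} (hsq : ∀ i, Squarefree (L i))
    (hco : ∀ i j, i ≠ j → (L i).Coprime (L j)) : Squarefree (∏ i, L i) := by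
  classical
  have key : ∀ s : Finset (Fin k), Squarefree (∏ i ∈ s, L i) := by
    intro s
    induction s using Finset.induction_on with
    | empty => simp
    | insert a s ha ih =>
      rw [Finset.prod_insert ha, Nat.squarefree_mul (Nat.Coprime.prod_right fun i hi =>
        hco a i (fun h => ha (h ▸ hi)))]
      exact ⟨hsq a, ih⟩
  exact key Finset.univ

/-- For a compatible pair of good tuples: `q(d, e) = W ∏ [dᵢ, eᵢ]` is squarefree (when `W` is) and
`≤ W (∏ dᵢ)(∏ eᵢ)`. [cite: MaynardAnnals2015, proof of Lemma 5.2] -/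
theorem squarefree_qmod {W : ℕ} (hW : Squarefree W) {d e : Fin k → ℕ} (hd : IsGood W d) (he : IsGood W e)
    (hc : ∀ p : OffDiag k, (d p.1.1).Coprime (e p.1.2)) : Squarefree (qmod W d e) := by
  have hLW : ∀ i, (Nat.lcm (d i) (e i)).Coprime W := fun i =>
    Nat.Coprime.coprime_dvd_left (Nat.lcm_dvd_mul (d i) (e i))
      (Nat.Coprime.mul_left (hd.coprime_apply i) (he.coprime_apply i))
  have hLL : ∀ i j, i ≠ j → (Nat.lcm (d i) (e i)).Coprime (Nat.lcm (d j) (e j)) := fun i j hij => by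
    have hde : (d i).Coprime (e j) := hc ⟨(i, j), hij⟩
    have hed : (e i).Coprime (d j) := (hc ⟨(j, i), hij.symm⟩).symm
    refine Nat.Coprime.coprime_dvd_left (Nat.lcm_dvd_mul _ _)
      (Nat.Coprime.coprime_dvd_right (Nat.lcm_dvd_mul _ _) ?_)
    exact Nat.Coprime.mul_left (Nat.Coprime.mul_right (hd.coprime_of_ne hij) hde)
      (Nat.Coprime.mul_right hed (he.coprime_of_ne hij))
  rw [qmod, Nat.squarefree_mul (Nat.Coprime.prod_right fun i _ => (hLW i).symm)]
  exact ⟨hW, squarefree_prod_fin (fun i => squarefree_lcm (hd.squarefree_apply i) (he.squarefree_apply i)) hLL⟩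

/-- `q(d, e) ≤ W (∏ dᵢ)(∏ eᵢ)`. [folklore] -/
theorem qmod_le {W : ℕ} {d e : Fin k → ℕ} (hd0 : ∀ i, d i ≠ 0) (he0 : ∀ i, e i ≠ 0) :
    qmod W d e ≤ W * ((∏ i, d i) * ∏ i, e i) := by
  rw [qmod, ← Finset.prod_mul_distrib]
  refine Nat.mul_le_mul_left W (Finset.prod_le_prod' fun i _ => ?_)
  exact Nat.le_of_dvd (Nat.pos_of_ne_zero (mul_ne_zero (hd0 i) (he0 i))) (Nat.lcm_dvd_mul _ _)

/-- `τ(q) = 2^{ω(q)}` for squarefree `q`. [folklore] -/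
theorem card_divisors_of_squarefree {q : ℕ} (hq : Squarefree q) : q.divisors.card = 2 ^ ω q := by
  rw [Nat.card_divisors hq.ne_zero, ArithmeticFunction.cardDistinctFactors_apply,
    ← List.card_toFinset]
  have : ∀ p ∈ q.primeFactors, q.factorization p + 1 = 2 := fun p hp => by
    have h1 := (Nat.squarefree_iff_factorization_le_one hq.ne_zero).1 hq p
    have h2 : 0 < q.factorization p :=
      Nat.Prime.factorization_pos_of_dvd (Nat.prime_of_mem_primeFactors hp) hq.ne_zero
        (Nat.dvd_of_mem_primeFactors hp)
    omega
  rw [Finset.prod_congr rfl this, Finset.prod_const]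
  rfl

/-- **Regrouping by the modulus** (Maynard 2015, proof of Lemma 5.2: a squarefree `r < R²W` arises
from at most `τ_{3k}(r)` pairs `(d, e)`; here the cruder `τ(q)^{2k} = (4^k)^{ω(q)}`): for `f ≥ 0`,
`Σ'_{d,e good, ∏dᵢ ≤ X, ∏eᵢ ≤ X} f(q(d,e)) ≤ Σ_{q ≤ W X², q squarefree} (4^k)^{ω(q)} f(q)`
(`W` squarefree). [cite: MaynardAnnals2015, proof of Lemma 5.2] -/
theorem sum_pairs_le_sum_moduli {W B X : ℕ} (hW : Squarefree W) {f : ℕ → ℝ} (hf : ∀ q, 0 ≤ f q) :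
    ∑ de ∈ ((boxG k W B) ×ˢ (boxG k W B)).filter (fun de =>
        (∀ p : OffDiag k, (de.1 p.1.1).Coprime (de.2 p.1.2)) ∧ ∏ i, de.1 i ≤ X ∧ ∏ i, de.2 i ≤ X),
        f (qmod W de.1 de.2) ≤
      ∑ q ∈ (Finset.Icc 1 (W * (X * X))).filter Squarefree, ((4 : ℝ) ^ k) ^ ω q * f q := by
  classical
  set P := ((boxG k W B) ×ˢ (boxG k W B)).filter (fun de =>
    (∀ p : OffDiag k, (de.1 p.1.1).Coprime (de.2 p.1.2)) ∧ ∏ i, de.1 i ≤ X ∧ ∏ i, de.2 i ≤ X) with hP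
  set g : (Fin k → ℕ) × (Fin k → ℕ) → ℕ := fun de => qmod W de.1 de.2 with hg
  have hmemP : ∀ de ∈ P, IsGood W de.1 ∧ IsGood W de.2 ∧
      (∀ p : OffDiag k, (de.1 p.1.1).Coprime (de.2 p.1.2)) ∧ ∏ i, de.1 i ≤ X ∧ ∏ i, de.2 i ≤ X := by
    intro de hde
    rw [hP, Finset.mem_filter, Finset.mem_product] at hde
    exact ⟨(mem_boxG.1 hde.1.1).2, (mem_boxG.1 hde.1.2).2, hde.2.1, hde.2.2⟩
  -- the image lies in the squarefree `q ≤ W X²`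
  have himage : P.image g ⊆ (Finset.Icc 1 (W * (X * X))).filter Squarefree := by
    intro q hq
    rw [Finset.mem_image] at hq
    obtain ⟨de, hde, rfl⟩ := hq
    obtain ⟨hd, he, hc, hdX, heX⟩ := hmemP de hde
    have hsq := squarefree_qmod hW hd he hc
    rw [Finset.mem_filter, Finset.mem_Icc]
    refine ⟨⟨Nat.pos_of_ne_zero hsq.ne_zero, ?_⟩, hsq⟩
    exact (qmod_le hd.ne_zero he.ne_zero).trans (Nat.mul_le_mul_left W (Nat.mul_le_mul hdX heX))
  -- the fibres have at most `τ(q)^{2k}` elements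
  have hfibre : ∀ q ∈ P.image g, ((P.filter fun de => g de = q).card : ℝ) ≤ ((4 : ℝ) ^ k) ^ ω q := by
    intro q hq
    have hsq : Squarefree q := (Finset.mem_filter.1 (himage hq)).2
    have hq0 : q ≠ 0 := hsq.ne_zero
    have hsub : P.filter (fun de => g de = q) ⊆
        (Fintype.piFinset fun _ : Fin k => q.divisors) ×ˢ (Fintype.piFinset fun _ : Fin k => q.divisors) := by
      intro de hde
      rw [Finset.mem_filter] at hde
      obtain ⟨hdeP, hdeq⟩ := hde
      have hdvd : ∀ i, de.1 i ∣ q ∧ de.2 i ∣ q := by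
        intro i
        have hL : Nat.lcm (de.1 i) (de.2 i) ∣ q := by
          rw [← hdeq, hg]
          exact (Finset.dvd_prod_of_mem (fun j => Nat.lcm (de.1 j) (de.2 j)) (Finset.mem_univ i)).trans
            (dvd_mul_left _ _)
        exact ⟨(Nat.dvd_lcm_left _ _).trans hL, (Nat.dvd_lcm_right _ _).trans hL⟩
      rw [Finset.mem_product, Fintype.mem_piFinset, Fintype.mem_piFinset]
      exact ⟨fun i => Nat.mem_divisors.2 ⟨(hdvd i).1, hq0⟩, fun i => Nat.mem_divisors.2 ⟨(hdvd i).2, hq0⟩⟩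
    have hcard := Finset.card_le_card hsub
    rw [Finset.card_product, Fintype.card_piFinset, Finset.prod_const, Finset.card_univ,
      Fintype.card_fin, card_divisors_of_squarefree hsq] at hcard
    calc ((P.filter fun de => g de = q).card : ℝ) ≤ (((2 ^ ω q) ^ k * (2 ^ ω q) ^ k : ℕ) : ℝ) := by
          exact_mod_cast hcard
      _ = ((4 : ℝ) ^ k) ^ ω q := by
          push_cast
          rw [← pow_mul, ← pow_mul, ← mul_pow, show (2 : ℝ) * 2 = 4 by norm_num, mul_comm]
  -- regroup
  rw [Finset.sum_comp f g]
  calc ∑ q ∈ P.image g, (P.filter fun de => g de = q).card • f q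
      ≤ ∑ q ∈ P.image g, ((4 : ℝ) ^ k) ^ ω q * f q := by
        refine Finset.sum_le_sum fun q hq => ?_
        rw [nsmul_eq_mul]
        exact mul_le_mul_of_nonneg_right (hfibre q hq) (hf q)
    _ ≤ _ := Finset.sum_le_sum_of_subset_of_nonneg himage fun q _ _ => by
        have := hf q; positivity

/-- **The error of Lemma 5.2 regrouped**: with `λ_max ≥ |λ_d|` and `λ` living on tuples of product
`≤ X`,
`Σ'_{d,e} |λ^{(m)}_d λ^{(m)}_e| (E(X₂; q) + E(X₁; q)) ≤ λ_max² Σ_{q ≤ W X², q squarefree} (4^k)^{ω(q)} (E(X₂; q) + E(X₁; q))`.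
[cite: MaynardAnnals2015, proof of Lemma 5.2, (5.16)] -/
theorem sum_err_le {W B X : ℕ} (hWsq : Squarefree W) {y : (Fin k → ℕ) → ℝ} (hy : SupportedOn W B y)
    (hyX : ∀ r, y r ≠ 0 → ∏ i, r i ≤ X) {lmax : ℝ} (hlmax : ∀ d, |lam B y d| ≤ lmax)
    (h : Fin k → ℤ) (N : ℕ) (m : Fin k) :
    ∑ d ∈ boxG k W B, ∑ e ∈ boxG k W B,
        (if ∀ p : OffDiag k, (d p.1.1).Coprime (e p.1.2) then
          |lamM B y m d| * |lamM B y m e| * apErr W h N m d e else 0) ≤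
      lmax ^ 2 * ∑ q ∈ (Finset.Icc 1 (W * (X * X))).filter Squarefree,
        ((4 : ℝ) ^ k) ^ ω q *
          (primeCountingAPErr ((X2 h N m : ℕ) : ℝ) q + primeCountingAPErr ((X1 h N m : ℕ) : ℝ) q) := by
  classical
  have hl0 : 0 ≤ lmax := (abs_nonneg _).trans (hlmax fun _ => 1)
  have hlamM : ∀ d, |lamM B y m d| ≤ lmax := fun d => by
    rw [lamM_def]; split_ifs
    · exact hlmax d
    · rw [abs_zero]; exact hl0
  -- drop the pairs with a vanishing `λ^{(m)}`, bound `|λ^{(m)}| ≤ λ_max`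
  set f : ℕ → ℝ := fun q => primeCountingAPErr ((X2 h N m : ℕ) : ℝ) q +
    primeCountingAPErr ((X1 h N m : ℕ) : ℝ) q with hf
  have hf0 : ∀ q, 0 ≤ f q := fun q => add_nonneg (primeCountingAPErr_nonneg _ _) (primeCountingAPErr_nonneg _ _)
  have hapErr : ∀ d e, apErr W h N m d e = f (qmod W d e) := fun d e => rfl
  have hterm : ∀ d ∈ boxG k W B, ∀ e ∈ boxG k W B,
      (if ∀ p : OffDiag k, (d p.1.1).Coprime (e p.1.2) then
          |lamM B y m d| * |lamM B y m e| * apErr W h N m d e else 0) ≤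
        lmax ^ 2 * (if (∀ p : OffDiag k, (d p.1.1).Coprime (e p.1.2)) ∧ ∏ i, d i ≤ X ∧ ∏ i, e i ≤ X then
          f (qmod W d e) else 0) := by
    intro d _ e _
    by_cases hc : ∀ p : OffDiag k, (d p.1.1).Coprime (e p.1.2)
    · rw [if_pos hc]
      by_cases hX : ∏ i, d i ≤ X ∧ ∏ i, e i ≤ X
      · rw [if_pos ⟨hc, hX⟩, hapErr]
        have hde : |lamM B y m d| * |lamM B y m e| ≤ lmax * lmax :=
          mul_le_mul (hlamM d) (hlamM e) (abs_nonneg _) hl0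
        calc |lamM B y m d| * |lamM B y m e| * f (qmod W d e) ≤ lmax * lmax * f (qmod W d e) :=
              mul_le_mul_of_nonneg_right hde (hf0 _)
          _ = lmax ^ 2 * f (qmod W d e) := by ring
      · -- one of `λ_d, λ_e` vanishes
        rw [if_neg (fun h' => hX h'.2)]
        have h0 : lamM B y m d * lamM B y m e = 0 := by
          rw [not_and_or] at hX
          rcases hX with hX | hX
          · have : lam B y d = 0 := by
              by_contra hne; exact hX (prod_le_of_lam_ne_zero hy hyX hne)
            rw [lamM_def]; simp [this]
          · have : lam B y e = 0 := by
              by_contra hne; exact hX (prod_le_of_lam_ne_zero hy hyX hne)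
            simp [this, lamM_def]
        rw [← abs_mul, h0, abs_zero, zero_mul, mul_zero]
    · rw [if_neg hc, if_neg (fun h' => hc h'.1), mul_zero]
  calc _ ≤ ∑ d ∈ boxG k W B, ∑ e ∈ boxG k W B, lmax ^ 2 *
        (if (∀ p : OffDiag k, (d p.1.1).Coprime (e p.1.2)) ∧ ∏ i, d i ≤ X ∧ ∏ i, e i ≤ X then
          f (qmod W d e) else 0) :=
        Finset.sum_le_sum fun d hd => Finset.sum_le_sum fun e he => hterm d hd e he
    _ = lmax ^ 2 * ∑ de ∈ ((boxG k W B) ×ˢ (boxG k W B)).filter (fun de =>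
          (∀ p : OffDiag k, (de.1 p.1.1).Coprime (de.2 p.1.2)) ∧ ∏ i, de.1 i ≤ X ∧ ∏ i, de.2 i ≤ X),
          f (qmod W de.1 de.2) := by
        rw [Finset.sum_filter, Finset.sum_product]
        simp only [← Finset.mul_sum]
    _ ≤ _ := mul_le_mul_of_nonneg_left (sum_pairs_le_sum_moduli hWsq hf0) (by positivity)

end MaynardSieve

/-! ### Specialisation to the weights of Proposition 4.1 -/

/-- `maynardS2 = MaynardSieve.S2` for `B = ⌊R⌋`, `y = maynardY k F R W` (by `maynardWeight_eq_lam`;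
the boxes agree by definition). [cite: MaynardAnnals2015, §5, definition of S₂^(m) (p. 10)] -/
theorem maynardS2_eq_S2 (k : ℕ) (h : Fin k → ℤ) (F : (Fin k → ℝ) → ℝ) (R : ℝ) (W v₀ N : ℕ) (m : Fin k) :
    maynardS2 k h F R W v₀ N m = MaynardSieve.S2 W ⌊R⌋₊ (maynardY k F R W) h v₀ N m := by
  simp only [maynardS2, maynardDivisorSum, maynardWeight_eq_lam]
  rfl

/-- The diagonal sum of Lemma 5.2 over the good tuples, in the `y^{(m)}`/`g` of `MaynardSieveBilinear`,
is the sum over the whole box in the `maynardYm`/`maynardG` of `MaynardSieveWeightsM`/`MaynardSieveS2`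
(`y^{(m)} = 0` off the good tuples; `g = gAF` on squarefree arguments). [cite: MaynardAnnals2015, Lemma 5.2] -/
theorem sum_boxG_ym_sq_div_eq (k : ℕ) (F : (Fin k → ℝ) → ℝ) (R : ℝ) (W : ℕ) (m : Fin k) :
    ∑ u ∈ MaynardSieve.boxG k W ⌊R⌋₊,
        MaynardSieve.ym W ⌊R⌋₊ (maynardY k F R W) m u ^ 2 / ∏ i, MaynardSieve.gAF (u i) =
      ∑ r ∈ maynardBox k R, maynardYm k F R W m r ^ 2 / ∏ i, maynardG (r i) := by
  have hsub : MaynardSieve.boxG k W ⌊R⌋₊ ⊆ maynardBox k R := Finset.filter_subset _ _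
  have hbox : ∑ r ∈ maynardBox k R, maynardYm k F R W m r ^ 2 / ∏ i, maynardG (r i) =
      ∑ r ∈ MaynardSieve.boxG k W ⌊R⌋₊, maynardYm k F R W m r ^ 2 / ∏ i, maynardG (r i) := by
    symm
    refine Finset.sum_subset hsub fun r _ hrG => ?_
    rw [maynardYm_eq_zero_of_not_mem_boxG F R W m hrG]; simp
  rw [hbox]
  refine Finset.sum_congr rfl fun u hu => ?_
  rw [maynardYm_eq_ym]
  congr 1
  refine Finset.prod_congr rfl fun i _ => ?_
  exact (maynardG_eq_gAF_of_squarefree ((MaynardSieve.mem_boxG.1 hu).2.squarefree_apply i)).symm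

/-- **Maynard 2015, Lemma 5.2 for the weights of Prop. 4.1, non-asymptotic form**: for `k ≥ 1`,
`R > 1`, `W ≥ 1` even and squarefree, `F = G · 1_{R_k}` with `|G| ≤ G_max` on `R_k`, shifts `h` whose
cross-differences have all prime factors dividing `W`, `(v₀ + h_m, W) = 1`, `N + h_m > ⌊R⌋`
(and `≥ 1`), and `|y^{(m)}_r| ≤ Y` on the box:
`|S₂^{(m)} − (X_N/φ(W)) Σ_r (y^{(m)}_r)²/∏ g(rᵢ)| ≤ (X_N/φ(W)) Y² L_g^{k−1} (Z_g^{k²−k} − 1)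
  + (G_max L^{2k})² Σ_{q ≤ W⌊R⌋², q squarefree} (4^k)^{ω(q)} (E(X₂; q) + E(X₁; q))`,
`L_g = Σ_{n ≤ R good} 1/g(n)`, `Z_g = Σ_{n ≤ R good} 1/g(n)²`, `L = Σ_{n ≤ R good} 1/φ(n)`,
`X_N = π(X₂) − π(X₁)`, `X₂ = 2N + h_m − 1`, `X₁ = N + h_m − 1`. [cite: MaynardAnnals2015, Lemma 5.2] -/
theorem abs_maynardS2_sub_main_le {k : ℕ} (h : Fin k → ℤ) (G : (Fin k → ℝ) → ℝ)
    {R : ℝ} (hR : 1 < R) {W : ℕ} (hW : W ≠ 0) (hW2 : 2 ∣ W) (hWsq : Squarefree W) {Gmax : ℝ} (hG0 : 0 ≤ Gmax)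
    (hG : ∀ x ∈ maynardSimplex k, |G x| ≤ Gmax)
    (hh : ∀ i j, i ≠ j → ∀ p : ℕ, p.Prime → (p : ℤ) ∣ h i - h j → p ∣ W) {v₀ : ℕ} {m : Fin k}
    (hv₀ : Int.gcd ((v₀ : ℤ) + h m) W = 1) {N : ℕ} (hN1 : 1 ≤ (N : ℤ) + h m) (hNB : (⌊R⌋₊ : ℤ) < N + h m)
    {Y : ℝ} (hY : ∀ r ∈ maynardBox k R, |maynardYm k ((maynardSimplex k).indicator G) R W m r| ≤ Y) :
    |maynardS2 k h ((maynardSimplex k).indicator G) R W v₀ N m -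
        (MaynardSieve.primesX h N m : ℝ) / Nat.totient W *
          ∑ r ∈ maynardBox k R, maynardYm k ((maynardSimplex k).indicator G) R W m r ^ 2 / ∏ i, maynardG (r i)| ≤
      (MaynardSieve.primesX h N m : ℝ) / Nat.totient W *
          (Y ^ 2 * (∑ n ∈ MaynardSieve.G1 W ⌊R⌋₊, 1 / MaynardSieve.gAF n) ^ (k - 1) *
            ((∑ n ∈ MaynardSieve.G1 W ⌊R⌋₊, 1 / MaynardSieve.gAF n ^ 2) ^
              Fintype.card (MaynardSieve.OffDiag k) - 1)) +
        (Gmax * (∑ n ∈ MaynardSieve.G1 W ⌊R⌋₊, 1 / (n.totient : ℝ)) ^ (2 * k)) ^ 2 *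
          ∑ q ∈ (Finset.Icc 1 (W * (⌊R⌋₊ * ⌊R⌋₊))).filter Squarefree, ((4 : ℝ) ^ k) ^ ω q *
            (primeCountingAPErr ((MaynardSieve.X2 h N m : ℕ) : ℝ) q +
              primeCountingAPErr ((MaynardSieve.X1 h N m : ℕ) : ℝ) q) := by
  have hB : 1 ≤ ⌊R⌋₊ := Nat.le_floor (by simpa using hR.le)
  have hy := supportedOn_maynardY k ((maynardSimplex k).indicator G) R W
  have hymax := abs_maynardY_le k G R W hG0 hG
  have hyX : ∀ r, maynardY k ((maynardSimplex k).indicator G) R W r ≠ 0 → ∏ i, r i ≤ ⌊R⌋₊ :=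
    fun r hr => prod_le_of_maynardY_ne_zero k G hR W hr
  have hym : ∀ u ∈ MaynardSieve.boxG k W ⌊R⌋₊,
      |MaynardSieve.ym W ⌊R⌋₊ (maynardY k ((maynardSimplex k).indicator G) R W) m u| ≤ Y := by
    intro u hu
    rw [← maynardYm_eq_ym]
    exact hY u (MaynardSieve.mem_boxG.1 hu).1
  have h1 := MaynardSieve.abs_S2_sub_main_le hW hW2 hB hy hym hh hv₀ hN1 hNB
  have hlmax := MaynardSieve.abs_lam_le hy hymax
  have h2 := MaynardSieve.sum_err_le hWsq hy hyX hlmax h N m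
  rw [maynardS2_eq_S2, ← sum_boxG_ym_sq_div_eq]
  linarith [h1, h2]

end Literature.NumberTheory.Sieve
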